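import Literature.MathematicalPhysics.QuantumFieldTheory.Balaban1983to89.B1Eq324BenfattoAppendixCLemma2
import Literature.MathematicalPhysics.QuantumFieldTheory.Balaban1983to89.B1Eq324BenfattoAppendixC2
import Literature.Probability.Process.GaussianProcessLaw
import Mathlib.Probability.Distributions.Gaussian.HasGaussianLaw.Independence
import HarnessLib

/-!
# `Balaban1983to89.B1Eq324BenfattoCondLaw` — [BenfattoEtAl1978] p. 152 / App. C point 2) p. 164: the tree's conditioned field
# `condField d α β Γ z̄` IS the conditional law of the free field (1.1) given its values on `Γ` — the disintegration
# `P̂₀(dξ) = ∫ P̂₀(dz̄) P̂₀(dξ | z̄_Γ)` PROVED (closing the HONEST-SCOPE caveat of `B1Eq324BenfattoLemma.condField`)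

statement-level skeleton of published theorems with citation tags; proofs where landed; nothing here is a claim about the
Yang–Mills mass gap

WHY THIS MODULE (cell `pub-ymgap`, seat `dag-n08-b`, node N08 «first missing estimate» lane; referee condition (c1), second half, on
`B1Eq324BenfattoCondCentre` / `…AppendixCLemma2`).  The typer's dictionary for [BenfattoEtAl1978] reads «P̄(dz) = P̂₀(dz | (z̄_Δ)_{Δ∈C})»
(p. 152; App. C 2) p. 164 «the above probability measure conditioned to fixed values of the z_Δ's, Δ ∈ Γ … a non centered gaussian
field with covariance C^Γ … and center u_Δ») as `condField d α β Γ z̄` := the Schur-complement Gaussian field shifted by the regression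
mean, DEFINED by the regression formulae, with the stated HONEST SCOPE *"its identification with a regular conditional distribution
of `P0` given the coordinates in `C` is NOT proved here"* (`B1Eq324BenfattoLemma` :262–265).  This file proves that identification
in disintegration form, so that Lemma 2 of App. C (`B1Eq324BenfattoAppendixCLemma2.appC_lemma2`) and the centre bound (C.8)
(`B1Eq324BenfattoCondCentre`) are statements about THE conditional law of the free field, not about a look-alike.

WHAT IS PROVED (no definition, no named fact, no `sorry`; axioms standard), for `α, β > 0` and every finite `Γ`:
* §1 the COUPLING: on `P̂₀ ⊗ Q` (`Q` = the centred Gaussian field of the conditional covariance `condCov`, an honest Gaussian field by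
  `B1Eq324BenfattoAppendixCLemma2.isPosSemidefKernel_condCov_freeCov`) the field `W(ξ, ζ) = u(ξ) + ζ` (`u = condMean`) is a centred
  Gaussian process with covariance `Cov(u_s, u_t) + C^Γ_{st} = (K_{st} − C^Γ_{st}) + C^Γ_{st} = K_{st}` (`covariance_condMean` — the law of
  total covariance), hence **`map_coupling_eq_P0`**: `(P̂₀ ⊗ Q) ∘ W⁻¹ = P̂₀` (Gaussian laws are determined by mean and covariance,
  `IsGaussianProcess.map_eq_of_covariance_eq`, Kallenberg Lemma 13.1);
* §2 on `Γ` the coupling reproduces the conditioning values a.s.: `W(ξ, ζ)_c = ξ_c` (`u = ξ` on `Γ` since `K_ΓΓ` is invertible,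
  `B1Eq324BenfattoAppendixC2.isUnit_det_covGram_freeCov`; `ζ_c = 0` a.s. since `C^Γ_cc = 0`);
* §3 **`integral_condField_eq`** — THE DISINTEGRATION: for every bounded measurable `g : (Γ → ℝ) × (Q₀ → ℝ) → ℝ`,
  `∫ g(ξ|_Γ, ξ) P̂₀(dξ) = ∫ ( ∫ g(ξ|_Γ, z) condField(Γ, ξ)(dz) ) P̂₀(dξ)`, i.e. `z̄ ↦ condField d α β Γ z̄` (which reads `z̄` only on `Γ`)
  is a regular conditional distribution of the field given its restriction to `Γ` — the defining property of Mathlib's `condDistrib`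
  (consumers wanting the kernel statement apply `condDistrib_ae_eq_of_measure_eq_compProd`).

NOT summit progress; count-neutral for N08; nothing of [Balaban1985UV3] is asserted.
-/

noncomputable section

open MeasureTheory ProbabilityTheory Finset Matrix
open scoped BigOperators Matrix NNReal ENNReal

namespace Literature.MathematicalPhysics.QuantumFieldTheory.Balaban1983to89.B1Eq324BenfattoCondLaw

open Literature.MathematicalPhysics.QuantumFieldTheory
open Literature.MathematicalPhysics.QuantumFieldTheory.Balaban1983to89.B1Eq324BenfattoLemma
open Literature.MathematicalPhysics.QuantumFieldTheory.Balaban1983to89.B1Eq324BenfattoCondCentre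
open Literature.MathematicalPhysics.QuantumFieldTheory.Balaban1983to89.B1Eq324BenfattoAppendixCLemma2
open Literature.MathematicalPhysics.QuantumFieldTheory.Balaban1983to89.B1Eq324BenfattoAppendixC2

variable {d : ℕ}

/-! ## §1  The coupling `W(ξ, ζ) = u(ξ) + ζ` on `P̂₀ ⊗ Q` has law `P̂₀` -/

section Coupling

/-- The regression mean as a linear form in the conditioning values: `u_s(ξ) = Σ_{c′∈Γ} w_s(c′) ξ_{c′}`,
`w_s(c′) = Σ_c K(s,c)(K_ΓΓ)⁻¹_{cc′}`. [cite: BenfattoEtAl1978, Appendix C (C.7) p.164] -/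
theorem condMean_eq_sum_weight_mul (Γ : Finset (B1Eq324BenfattoLemma.Site d))
    (G : B1Eq324BenfattoLemma.Site d → B1Eq324BenfattoLemma.Site d → ℝ)
    (zbar : B1Eq324BenfattoLemma.Site d → ℝ) (s : B1Eq324BenfattoLemma.Site d) :
    condMean G Γ zbar s = ∑ c' : Γ, (∑ c : Γ, G s c * (covGram G Γ)⁻¹ c c') * zbar c' := by
  simp only [condMean]
  rw [Finset.sum_comm]
  refine Finset.sum_congr rfl fun c' _ => ?_
  rw [Finset.sum_mul]

variable {α β : ℝ} (hα : 0 < α) (hβ : 0 < β) (Γ : Finset (B1Eq324BenfattoLemma.Site d))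

include hα hβ

/-- **Law of total covariance for the regression**: `Cov_{P̂₀}(u_s, u_t) = K(s,t) − C^Γ(s,t)` — the covariance of the regression means
is the free covariance minus the conditional one (`K_sΓ K_ΓΓ⁻¹ K_ΓΓ K_ΓΓ⁻¹ K_Γt = K_sΓ K_ΓΓ⁻¹ K_Γt`, `K_ΓΓ` invertible).
[cite: BenfattoEtAl1978, Appendix C (C.6)–(C.7) p.164] -/
theorem covariance_condMean (s t : B1Eq324BenfattoLemma.Site d) :
    cov[fun ξ => condMean (freeCov d α β) Γ ξ s, fun ξ => condMean (freeCov d α β) Γ ξ t; P0 d α β] =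
      freeCov d α β s t - condCov (freeCov d α β) Γ s t := by
  haveI : IsProbabilityMeasure (P0 d α β) := isProbabilityMeasure_P0 hα hβ
  set K := freeCov d α β with hK
  set A : Matrix Γ Γ ℝ := covGram K Γ with hA
  have hKpsd := isPosSemidefKernel_freeCov (d := d) hα hβ
  have hdet : IsUnit A.det := isUnit_det_covGram_freeCov hα hβ Γ
  have hKs : ∀ x y, K x y = K y x := fun x y => freeCov_comm α β x y
  have hAs : ∀ c c' : Γ, A c c' = A c' c := fun c c' => by simp only [hA, covGram_apply, hKs]
  have hAinv : ∀ c c' : Γ, A⁻¹ c c' = A⁻¹ c' c := by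
    intro c c'
    have hAt : Aᵀ = A := by ext i j; exact hAs j i
    have h := congrFun (congrFun (Matrix.transpose_nonsing_inv A) c') c
    rw [Matrix.transpose_apply, hAt] at h
    exact h
  -- weights
  set w : B1Eq324BenfattoLemma.Site d → Γ → ℝ := fun r c' => ∑ c : Γ, K r c * A⁻¹ c c' with hw
  have hu : ∀ r, (fun ξ : B1Eq324BenfattoLemma.Site d → ℝ => condMean K Γ ξ r) =
      fun ξ => ∑ c' : Γ, w r c' * ξ c' := fun r => funext fun ξ => condMean_eq_sum_weight_mul Γ K ξ r
  have hmem : ∀ c : Γ, MemLp (fun ξ : B1Eq324BenfattoLemma.Site d → ℝ => ξ c) 2 (P0 d α β) := fun c =>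
    ((isGaussianProcess_P0 (d := d) hα hβ).hasGaussianLaw_eval (c : B1Eq324BenfattoLemma.Site d)).memLp_two
  rw [hu s, hu t, covariance_fun_sum_fun_sum (fun c' => (hmem c').const_mul _) (fun c' => (hmem c').const_mul _)]
  simp only [covariance_const_mul_left, covariance_const_mul_right]
  have hcov : ∀ i j : Γ, cov[fun ξ : B1Eq324BenfattoLemma.Site d → ℝ => ξ i, fun ξ => ξ j; P0 d α β] = A i j := by
    intro i j
    rw [hA, covGram_apply, hK, P0]
    exact covariance_eval_gaussianFieldOfKernel hKpsd _ _
  simp only [hcov]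
  -- `Σ_i Σ_j w_s i w_t j A i j = Σ_j K s j w_t j = K s t − condCov s t`
  have hstep : ∀ j : Γ, ∑ i : Γ, w s i * A i j = K s j := by
    intro j
    have e : ∑ i : Γ, w s i * A i j = ∑ c : Γ, K s c * (A⁻¹ * A) c j := by
      simp only [hw, Finset.sum_mul, Matrix.mul_apply, Finset.mul_sum]
      rw [Finset.sum_comm]
      exact Finset.sum_congr rfl fun c _ => Finset.sum_congr rfl fun i _ => by ring
    rw [e, Matrix.nonsing_inv_mul _ hdet]
    simp [Matrix.one_apply]
  calc ∑ i : Γ, ∑ j : Γ, w t j * (w s i * A i j)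
      = ∑ j : Γ, (∑ i : Γ, w s i * A i j) * w t j := by
        rw [Finset.sum_comm]
        refine Finset.sum_congr rfl fun j _ => ?_
        rw [Finset.sum_mul]
        refine Finset.sum_congr rfl fun i _ => ?_
        ring
    _ = ∑ j : Γ, K s j * w t j := by simp only [hstep]
    _ = K s t - condCov K Γ s t := by
        simp only [condCov, sub_sub_cancel, hw, Finset.mul_sum]
        refine Finset.sum_congr rfl fun c _ => Finset.sum_congr rfl fun j _ => ?_
        rw [hAinv j c, hKs (t : B1Eq324BenfattoLemma.Site d) j]
        ring

/-- **The coupling reproduces the free field**: with `Q` the centred Gaussian field of the conditional covariance `C^Γ` and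
`W(ξ, ζ) = u(ξ) + ζ`, the image of `P̂₀ ⊗ Q` under `W` is `P̂₀` — `W` is a centred Gaussian process (a linear image of the
independent Gaussian pair `(ξ|_Γ, ζ)`) with covariance `(K − C^Γ) + C^Γ = K`, and Gaussian laws are determined by mean and
covariance. [cite: Kallenberg2002, Lemma 13.1] -/
theorem map_coupling_eq_P0 :
    ((P0 d α β).prod (gaussianFieldOfKernel (condCov (freeCov d α β) Γ))).map
        (fun p : (B1Eq324BenfattoLemma.Site d → ℝ) × (B1Eq324BenfattoLemma.Site d → ℝ) =>
          fun x => condMean (freeCov d α β) Γ p.1 x + p.2 x) = P0 d α β := by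
  set K := freeCov d α β with hK
  set μ := P0 d α β with hμ
  have hKpsd := isPosSemidefKernel_freeCov (d := d) hα hβ
  have hKc := isPosSemidefKernel_condCov_freeCov (d := d) hα hβ Γ
  set Q := gaussianFieldOfKernel (condCov K Γ) with hQ
  haveI : IsProbabilityMeasure μ := isProbabilityMeasure_P0 hα hβ
  haveI : IsProbabilityMeasure Q := isProbabilityMeasure_gaussianFieldOfKernel hKc
  set ν := μ.prod Q with hν
  have hfst : ν.map Prod.fst = μ := by rw [hν, Measure.map_fst_prod, measure_univ, one_smul]
  have hsnd : ν.map Prod.snd = Q := by rw [hν, Measure.map_snd_prod, measure_univ, one_smul]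
  -- the two processes on `ν`
  set X : B1Eq324BenfattoLemma.Site d → ((B1Eq324BenfattoLemma.Site d → ℝ) × (B1Eq324BenfattoLemma.Site d → ℝ)) → ℝ :=
    fun s p => p.1 s with hX
  set Y : B1Eq324BenfattoLemma.Site d → ((B1Eq324BenfattoLemma.Site d → ℝ) × (B1Eq324BenfattoLemma.Site d → ℝ)) → ℝ :=
    fun s p => condMean K Γ p.1 s + p.2 s with hY
  have hμproc : IsGaussianProcess (fun (s : B1Eq324BenfattoLemma.Site d) (ξ : B1Eq324BenfattoLemma.Site d → ℝ) => ξ s) μ :=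
    isGaussianProcess_P0 hα hβ
  have hQproc : IsGaussianProcess (fun (s : B1Eq324BenfattoLemma.Site d) (ζ : B1Eq324BenfattoLemma.Site d → ℝ) => ζ s) Q :=
    isGaussianProcess_eval_gaussianFieldOfKernel hKc
  -- measurability helpers
  have hres : ∀ I : Finset (B1Eq324BenfattoLemma.Site d),
      Measurable fun ω : B1Eq324BenfattoLemma.Site d → ℝ => I.restrict fun s => ω s :=
    fun I => measurable_pi_lambda _ fun s => measurable_pi_apply _
  have hum : ∀ s, Measurable fun ξ : B1Eq324BenfattoLemma.Site d → ℝ => condMean K Γ ξ s := by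
    intro s
    simp only [condMean]
    fun_prop
  have hYm : ∀ s, Measurable (Y s) := fun s =>
    ((hum s).comp measurable_fst).add ((measurable_pi_apply s).comp measurable_snd)
  -- X is a Gaussian process on ν (law of the first marginal)
  have hXproc : IsGaussianProcess X ν := by
    refine ⟨fun I => ⟨?_⟩⟩
    have hcomp : (fun ω => I.restrict fun s => X s ω) =
        (fun ω : B1Eq324BenfattoLemma.Site d → ℝ => I.restrict fun s => ω s) ∘ Prod.fst := rfl
    rw [hcomp, ← Measure.map_map (hres I) measurable_fst, hfst]
    exact (hμproc.hasGaussianLaw I).isGaussian_map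
  -- Y is a Gaussian process on ν: a linear image of the independent Gaussian pair (ξ|Γ, ζ|I)
  have hYproc : IsGaussianProcess Y ν := by
    refine ⟨fun I => ?_⟩
    -- the pair
    have h1 : HasGaussianLaw (fun p : (B1Eq324BenfattoLemma.Site d → ℝ) × (B1Eq324BenfattoLemma.Site d → ℝ) =>
        Γ.restrict fun s => p.1 s) ν := by
      refine ⟨?_⟩
      have hcomp : (fun p : (B1Eq324BenfattoLemma.Site d → ℝ) × (B1Eq324BenfattoLemma.Site d → ℝ) =>
          Γ.restrict fun s => p.1 s) = (fun ω : B1Eq324BenfattoLemma.Site d → ℝ => Γ.restrict fun s => ω s) ∘ Prod.fst := rfl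
      rw [hcomp, ← Measure.map_map (hres Γ) measurable_fst, hfst]
      exact (hμproc.hasGaussianLaw Γ).isGaussian_map
    have h2 : HasGaussianLaw (fun p : (B1Eq324BenfattoLemma.Site d → ℝ) × (B1Eq324BenfattoLemma.Site d → ℝ) =>
        I.restrict fun s => p.2 s) ν := by
      refine ⟨?_⟩
      have hcomp : (fun p : (B1Eq324BenfattoLemma.Site d → ℝ) × (B1Eq324BenfattoLemma.Site d → ℝ) =>
          I.restrict fun s => p.2 s) = (fun ω : B1Eq324BenfattoLemma.Site d → ℝ => I.restrict fun s => ω s) ∘ Prod.snd := rfl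
      rw [hcomp, ← Measure.map_map (hres I) measurable_snd, hsnd]
      exact (hQproc.hasGaussianLaw I).isGaussian_map
    have hind : IndepFun (fun p : (B1Eq324BenfattoLemma.Site d → ℝ) × (B1Eq324BenfattoLemma.Site d → ℝ) =>
        Γ.restrict fun s => p.1 s) (fun p => I.restrict fun s => p.2 s) ν :=
      indepFun_prod (hres Γ) (hres I)
    have hpair := IndepFun.hasGaussianLaw h1 h2 hind
    -- the linear map
    let L : ((Γ → ℝ) × (I → ℝ)) →L[ℝ] (I → ℝ) :=
      { toFun := fun ab s => (∑ c' : Γ, (∑ c : Γ, K s c * (covGram K Γ)⁻¹ c c') * ab.1 c') + ab.2 s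
        map_add' := fun x y => by
          funext s
          simp only [Prod.fst_add, Prod.snd_add, Pi.add_apply, mul_add, Finset.sum_add_distrib]
          ring
        map_smul' := fun m x => by
          funext s
          simp only [Prod.smul_fst, Prod.smul_snd, Pi.smul_apply, smul_eq_mul, RingHom.id_apply]
          rw [mul_add, Finset.mul_sum]
          congr 1
          exact Finset.sum_congr rfl fun i _ => by ring
        cont := by fun_prop }
    have hfun : (fun ω => I.restrict fun s => Y s ω) =
        L ∘ fun p => (Γ.restrict fun s => p.1 s, I.restrict fun s => p.2 s) := by
      funext p s
      simp only [hY, Function.comp_apply, Finset.restrict, condMean_eq_sum_weight_mul]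
      rfl
    rw [hfun]
    exact hpair.map L
  -- means
  have hmX : ∀ s, ν[X s] = 0 := by
    intro s
    have h := integral_map (μ := ν) (φ := Prod.fst) measurable_fst.aemeasurable
      (f := fun ω : B1Eq324BenfattoLemma.Site d → ℝ => ω s) (measurable_pi_apply s).aestronglyMeasurable
    rw [hfst] at h
    rw [hX]
    simp only
    rw [← h, hμ, P0]
    exact integral_eval_gaussianFieldOfKernel hKpsd s
  have hmu : ∀ s, ∫ ξ, condMean K Γ ξ s ∂μ = 0 := by
    intro s
    rw [show (fun ξ : B1Eq324BenfattoLemma.Site d → ℝ => condMean K Γ ξ s) = fun ξ => ∑ c' : Γ,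
        (∑ c : Γ, K s c * (covGram K Γ)⁻¹ c c') * ξ c' from funext fun ξ => condMean_eq_sum_weight_mul Γ K ξ s]
    rw [integral_finsetSum _ fun c' _ => ?_]
    · refine Finset.sum_eq_zero fun c' _ => ?_
      rw [integral_const_mul, hμ, P0, integral_eval_gaussianFieldOfKernel hKpsd, mul_zero]
    · exact ((hμproc.hasGaussianLaw_eval (c' : B1Eq324BenfattoLemma.Site d)).integrable).const_mul _
  have hmY : ∀ s, ν[Y s] = 0 := by
    intro s
    have hi1 : Integrable (fun p : (B1Eq324BenfattoLemma.Site d → ℝ) × (B1Eq324BenfattoLemma.Site d → ℝ) =>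
        condMean K Γ p.1 s) ν := by
      have : Integrable (fun ξ : B1Eq324BenfattoLemma.Site d → ℝ => condMean K Γ ξ s) (ν.map Prod.fst) := by
        rw [hfst]
        rw [show (fun ξ : B1Eq324BenfattoLemma.Site d → ℝ => condMean K Γ ξ s) = fun ξ => ∑ c' : Γ,
            (∑ c : Γ, K s c * (covGram K Γ)⁻¹ c c') * ξ c' from funext fun ξ => condMean_eq_sum_weight_mul Γ K ξ s]
        exact integrable_finsetSum _ fun c' _ =>
          ((hμproc.hasGaussianLaw_eval (c' : B1Eq324BenfattoLemma.Site d)).integrable).const_mul _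
      exact (integrable_map_measure (hum s).aestronglyMeasurable measurable_fst.aemeasurable).1 this
    have hi2 : Integrable (fun p : (B1Eq324BenfattoLemma.Site d → ℝ) × (B1Eq324BenfattoLemma.Site d → ℝ) => p.2 s) ν := by
      have : Integrable (fun ζ : B1Eq324BenfattoLemma.Site d → ℝ => ζ s) (ν.map Prod.snd) := by
        rw [hsnd]
        exact (hQproc.hasGaussianLaw_eval s).integrable
      exact (integrable_map_measure (measurable_pi_apply s).aestronglyMeasurable measurable_snd.aemeasurable).1 this
    rw [hY]
    simp only
    rw [integral_add hi1 hi2]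
    have e1 : ∫ p, condMean K Γ p.1 s ∂ν = ∫ ξ, condMean K Γ ξ s ∂μ := by
      have h := integral_map (μ := ν) (φ := Prod.fst) measurable_fst.aemeasurable
        (f := fun ξ : B1Eq324BenfattoLemma.Site d → ℝ => condMean K Γ ξ s) (hum s).aestronglyMeasurable
      rw [hfst] at h
      exact h.symm
    have e2 : ∫ p : (B1Eq324BenfattoLemma.Site d → ℝ) × (B1Eq324BenfattoLemma.Site d → ℝ), p.2 s ∂ν = ∫ ζ, ζ s ∂Q := by
      have h := integral_map (μ := ν) (φ := Prod.snd) measurable_snd.aemeasurable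
        (f := fun ζ : B1Eq324BenfattoLemma.Site d → ℝ => ζ s) (measurable_pi_apply s).aestronglyMeasurable
      rw [hsnd] at h
      exact h.symm
    rw [e1, e2, hmu, hQ, integral_eval_gaussianFieldOfKernel hKc, add_zero]
  -- covariances
  have hcX : ∀ s t, cov[X s, X t; ν] = K s t := by
    intro s t
    have h := covariance_map (μ := ν) (Z := Prod.fst) (X := fun ω : B1Eq324BenfattoLemma.Site d → ℝ => ω s)
      (Y := fun ω : B1Eq324BenfattoLemma.Site d → ℝ => ω t) (measurable_pi_apply s).aestronglyMeasurable
      (measurable_pi_apply t).aestronglyMeasurable measurable_fst.aemeasurable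
    rw [hfst] at h
    rw [hX]
    change cov[(fun ω : B1Eq324BenfattoLemma.Site d → ℝ => ω s) ∘ Prod.fst,
      (fun ω : B1Eq324BenfattoLemma.Site d → ℝ => ω t) ∘ Prod.fst; ν] = K s t
    rw [← h, hμ, P0]
    exact covariance_eval_gaussianFieldOfKernel hKpsd s t
  have hL2u : ∀ s, MemLp (fun p : (B1Eq324BenfattoLemma.Site d → ℝ) × (B1Eq324BenfattoLemma.Site d → ℝ) =>
      condMean K Γ p.1 s) 2 ν := by
    intro s
    have : MemLp (fun ξ : B1Eq324BenfattoLemma.Site d → ℝ => condMean K Γ ξ s) 2 μ := by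
      rw [show (fun ξ : B1Eq324BenfattoLemma.Site d → ℝ => condMean K Γ ξ s) = fun ξ => ∑ c' : Γ,
          (∑ c : Γ, K s c * (covGram K Γ)⁻¹ c c') * ξ c' from funext fun ξ => condMean_eq_sum_weight_mul Γ K ξ s]
      exact memLp_finsetSum _ fun c' _ =>
        ((hμproc.hasGaussianLaw_eval (c' : B1Eq324BenfattoLemma.Site d)).memLp_two).const_mul _
    exact this.comp_fst Q
  have hL2ζ : ∀ s, MemLp (fun p : (B1Eq324BenfattoLemma.Site d → ℝ) × (B1Eq324BenfattoLemma.Site d → ℝ) => p.2 s) 2 ν :=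
    fun s => ((hQproc.hasGaussianLaw_eval s).memLp_two).comp_snd μ
  have hcross : ∀ s t, cov[fun p : (B1Eq324BenfattoLemma.Site d → ℝ) × (B1Eq324BenfattoLemma.Site d → ℝ) => condMean K Γ p.1 s,
      fun p => p.2 t; ν] = 0 := fun s t =>
    covariance_fst_snd_prod (X := fun ξ : B1Eq324BenfattoLemma.Site d → ℝ => condMean K Γ ξ s)
      (Y := fun ζ : B1Eq324BenfattoLemma.Site d → ℝ => ζ t)
      (by
        rw [show (fun ξ : B1Eq324BenfattoLemma.Site d → ℝ => condMean K Γ ξ s) = fun ξ => ∑ c' : Γ,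
            (∑ c : Γ, K s c * (covGram K Γ)⁻¹ c c') * ξ c' from funext fun ξ => condMean_eq_sum_weight_mul Γ K ξ s]
        exact memLp_finsetSum _ fun c' _ =>
          ((hμproc.hasGaussianLaw_eval (c' : B1Eq324BenfattoLemma.Site d)).memLp_two).const_mul _)
      ((hQproc.hasGaussianLaw_eval t).memLp_two)
  have hcuu : ∀ s t, cov[fun p : (B1Eq324BenfattoLemma.Site d → ℝ) × (B1Eq324BenfattoLemma.Site d → ℝ) => condMean K Γ p.1 s,
      fun p => condMean K Γ p.1 t; ν] = K s t - condCov K Γ s t := by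
    intro s t
    have h := covariance_map (μ := ν) (Z := Prod.fst) (X := fun ξ : B1Eq324BenfattoLemma.Site d → ℝ => condMean K Γ ξ s)
      (Y := fun ξ : B1Eq324BenfattoLemma.Site d → ℝ => condMean K Γ ξ t) (hum s).aestronglyMeasurable
      (hum t).aestronglyMeasurable measurable_fst.aemeasurable
    rw [hfst] at h
    change cov[(fun ξ : B1Eq324BenfattoLemma.Site d → ℝ => condMean K Γ ξ s) ∘ Prod.fst,
      (fun ξ : B1Eq324BenfattoLemma.Site d → ℝ => condMean K Γ ξ t) ∘ Prod.fst; ν] = K s t - condCov K Γ s t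
    rw [← h, hμ, hK]
    exact covariance_condMean hα hβ Γ s t
  have hcζζ : ∀ s t, cov[fun p : (B1Eq324BenfattoLemma.Site d → ℝ) × (B1Eq324BenfattoLemma.Site d → ℝ) => p.2 s,
      fun p => p.2 t; ν] = condCov K Γ s t := by
    intro s t
    have h := covariance_map (μ := ν) (Z := Prod.snd) (X := fun ζ : B1Eq324BenfattoLemma.Site d → ℝ => ζ s)
      (Y := fun ζ : B1Eq324BenfattoLemma.Site d → ℝ => ζ t) (measurable_pi_apply s).aestronglyMeasurable
      (measurable_pi_apply t).aestronglyMeasurable measurable_snd.aemeasurable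
    rw [hsnd] at h
    change cov[(fun ζ : B1Eq324BenfattoLemma.Site d → ℝ => ζ s) ∘ Prod.snd,
      (fun ζ : B1Eq324BenfattoLemma.Site d → ℝ => ζ t) ∘ Prod.snd; ν] = condCov K Γ s t
    rw [← h, hQ]
    exact covariance_eval_gaussianFieldOfKernel hKc s t
  have hcY : ∀ s t, cov[Y s, Y t; ν] = K s t := by
    intro s t
    rw [hY]
    change cov[(fun p => condMean K Γ p.1 s) + fun p => p.2 s, (fun p => condMean K Γ p.1 t) + fun p => p.2 t; ν] = K s t
    rw [covariance_add_left (hL2u s) (hL2ζ s) ((hL2u t).add (hL2ζ t)),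
      covariance_add_right (hL2u s) (hL2u t) (hL2ζ t), covariance_add_right (hL2ζ s) (hL2u t) (hL2ζ t),
      hcuu, hcross, hcζζ]
    have hcross' : cov[fun p : (B1Eq324BenfattoLemma.Site d → ℝ) × (B1Eq324BenfattoLemma.Site d → ℝ) => p.2 s,
        fun p => condMean K Γ p.1 t; ν] = 0 := by
      rw [covariance_comm, hcross]
    rw [hcross']
    ring
  -- conclude
  have hXm : AEMeasurable (fun ω => (X · ω)) ν := measurable_fst.aemeasurable
  have hYm' : AEMeasurable (fun ω => (Y · ω)) ν := (measurable_pi_lambda _ fun s => hYm s).aemeasurable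
  have key := hXproc.map_eq_of_covariance_eq hYproc (fun s => by rw [hmX, hmY])
    (fun s t => by rw [hcX, hcY]) hXm hYm'
  have hXid : (fun ω => (X · ω)) = Prod.fst := by funext ω; rfl
  rw [hXid, hfst] at key
  exact key.symm

/-! ## §2  On `Γ` the coupling reproduces the conditioning values almost surely -/

/-- The conditional variance vanishes on the conditioning set: `C^Γ_cc = 0` for `c ∈ Γ` (`K_ΓΓ` invertible).
[cite: BenfattoEtAl1978, Appendix C (C.6)–(C.7) p.164] -/
theorem condCov_freeCov_self_eq_zero_of_mem {c : B1Eq324BenfattoLemma.Site d} (hc : c ∈ Γ) :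
    condCov (freeCov d α β) Γ c c = 0 := by
  rw [condCov_eq_sub_condMean, condMean_apply_of_mem (freeCov d α β) Γ (fun c' => freeCov d α β c' c)
    (isUnit_det_covGram_freeCov hα hβ Γ) hc, sub_self]

/-- Under the Schur field `Q` a conditioned coordinate vanishes a.s.: `ζ_c = 0` for `c ∈ Γ` (it is `N(0, C^Γ_cc) = N(0, 0) = δ₀`).
[cite: BenfattoEtAl1978, Appendix C (C.6)–(C.7) p.164] -/
theorem schurField_eval_ae_eq_zero {c : B1Eq324BenfattoLemma.Site d} (hc : c ∈ Γ) :
    ∀ᵐ ζ ∂gaussianFieldOfKernel (condCov (freeCov d α β) Γ), ζ c = 0 := by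
  have hKc := isPosSemidefKernel_condCov_freeCov (d := d) hα hβ Γ
  set Q := gaussianFieldOfKernel (condCov (freeCov d α β) Γ) with hQ
  haveI : IsProbabilityMeasure Q := isProbabilityMeasure_gaussianFieldOfKernel hKc
  have hX : HasGaussianLaw (fun ζ : B1Eq324BenfattoLemma.Site d → ℝ => ζ c) Q :=
    (isGaussianProcess_eval_gaussianFieldOfKernel hKc).hasGaussianLaw_eval c
  have hmap := hX.map_eq_gaussianReal
  have hmean : ∫ ζ, ζ c ∂Q = 0 := integral_eval_gaussianFieldOfKernel hKc c
  have hvar : Var[fun ζ : B1Eq324BenfattoLemma.Site d → ℝ => ζ c; Q] = 0 := by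
    rw [← covariance_self (measurable_pi_apply c).aemeasurable, covariance_eval_gaussianFieldOfKernel hKc c c]
    exact condCov_freeCov_self_eq_zero_of_mem hα hβ Γ hc
  rw [hmean, hvar, Real.toNNReal_zero, gaussianReal_zero_var] at hmap
  have hzero : Q {ζ | ζ c ≠ 0} = 0 := by
    have hset : {ζ : B1Eq324BenfattoLemma.Site d → ℝ | ζ c ≠ 0} = (fun ζ : B1Eq324BenfattoLemma.Site d → ℝ => ζ c) ⁻¹' {0}ᶜ := rfl
    rw [hset, ← Measure.map_apply (measurable_pi_apply c) (MeasurableSet.singleton 0).compl, hmap,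
      Measure.dirac_apply' _ (MeasurableSet.singleton 0).compl]
    simp
  rw [ae_iff]
  simpa using hzero

/-- **On `Γ` the coupling is the identity, a.s.**: `W(ξ, ζ)_c = ξ_c` for all `c ∈ Γ`, `(P̂₀ ⊗ Q)`-almost surely.
[cite: BenfattoEtAl1978, Appendix C (C.7) p.164] -/
theorem coupling_apply_ae_eq_of_mem :
    ∀ᵐ p ∂(P0 d α β).prod (gaussianFieldOfKernel (condCov (freeCov d α β) Γ)),
      ∀ c ∈ Γ, condMean (freeCov d α β) Γ p.1 c + p.2 c = p.1 c := by
  have hKc := isPosSemidefKernel_condCov_freeCov (d := d) hα hβ Γ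
  haveI : IsProbabilityMeasure (P0 d α β) := isProbabilityMeasure_P0 hα hβ
  haveI : IsProbabilityMeasure (gaussianFieldOfKernel (condCov (freeCov d α β) Γ)) :=
    isProbabilityMeasure_gaussianFieldOfKernel hKc
  have hdet := isUnit_det_covGram_freeCov (d := d) hα hβ Γ
  have hfin : ∀ c ∈ Γ, ∀ᵐ p ∂(P0 d α β).prod (gaussianFieldOfKernel (condCov (freeCov d α β) Γ)),
      condMean (freeCov d α β) Γ p.1 c + p.2 c = p.1 c := by
    intro c hc
    have h2 : ∀ᵐ p ∂(P0 d α β).prod (gaussianFieldOfKernel (condCov (freeCov d α β) Γ)),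
        (p.2 : B1Eq324BenfattoLemma.Site d → ℝ) c = 0 := by
      rw [ae_iff]
      have hset : {p : (B1Eq324BenfattoLemma.Site d → ℝ) × (B1Eq324BenfattoLemma.Site d → ℝ) | ¬p.2 c = 0} =
          (Set.univ : Set (B1Eq324BenfattoLemma.Site d → ℝ)) ×ˢ {ζ : B1Eq324BenfattoLemma.Site d → ℝ | ζ c ≠ 0} := by
        ext p
        simp
      rw [hset, Measure.prod_prod, ae_iff.1 (schurField_eval_ae_eq_zero hα hβ Γ hc), mul_zero]
    filter_upwards [h2] with p hp
    rw [hp, add_zero, condMean_apply_of_mem (freeCov d α β) Γ p.1 hdet hc]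
  exact (ae_ball_iff (Finset.countable_toSet Γ)).2 hfin

/-! ## §3  The disintegration: `condField` is the conditional law given the values on `Γ` -/

/-- **`P̄(dz) = P̂₀(dz | z̄_Γ)` — THE CONDITIONED FIELD IS THE CONDITIONAL LAW.**  For the free field (1.1) (`α, β > 0`), a finite
`Γ` and every bounded measurable `g : (Γ → ℝ) × (Q₀ → ℝ) → ℝ`:
`∫ g(ξ|_Γ, ξ) P̂₀(dξ) = ∫ ( ∫ g(ξ|_Γ, z) condField(Γ, ξ)(dz) ) P̂₀(dξ)` — i.e. `ξ ↦ condField d α β Γ ξ` (a function of `ξ|_Γ` only) is a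
regular conditional distribution of the field given its restriction to `Γ` (the defining identity of Mathlib's `condDistrib` /
`Measure.compProd`, in integral form).  Proof: the coupling `W = u(ξ) + ζ` on `P̂₀ ⊗ Q` has law `P̂₀` (`map_coupling_eq_P0`),
reproduces `ξ|_Γ` a.s. (`coupling_apply_ae_eq_of_mem`), and `condField(Γ, ξ) = Q ∘ (ζ ↦ u(ξ) + ζ)⁻¹`; Fubini.
[cite: BenfattoEtAl1978, p.152 «P̂₀(dz|(z̄_Δ)_{Δ∈C})»; Appendix C 2) p.164] -/
theorem integral_condField_eq {g : (Γ → ℝ) × (B1Eq324BenfattoLemma.Site d → ℝ) → ℝ} (hg : Measurable g) {M : ℝ}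
    (hM : ∀ z, |g z| ≤ M) :
    ∫ ξ, g (Γ.restrict ξ, ξ) ∂P0 d α β =
      ∫ ξ, (∫ z, g (Γ.restrict ξ, z) ∂condField d α β Γ ξ) ∂P0 d α β := by
  set K := freeCov d α β with hK
  set μ := P0 d α β with hμ
  have hKc := isPosSemidefKernel_condCov_freeCov (d := d) hα hβ Γ
  set Q := gaussianFieldOfKernel (condCov K Γ) with hQ
  haveI : IsProbabilityMeasure μ := isProbabilityMeasure_P0 hα hβ
  haveI : IsProbabilityMeasure Q := isProbabilityMeasure_gaussianFieldOfKernel hKc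
  set ν := μ.prod Q with hν
  -- the coupling map and its measurability
  set W : (B1Eq324BenfattoLemma.Site d → ℝ) × (B1Eq324BenfattoLemma.Site d → ℝ) → (B1Eq324BenfattoLemma.Site d → ℝ) :=
    fun p x => condMean K Γ p.1 x + p.2 x with hW
  have hum : ∀ x, Measurable fun ξ : B1Eq324BenfattoLemma.Site d → ℝ => condMean K Γ ξ x := by
    intro x
    simp only [condMean]
    fun_prop
  have hWm : Measurable W :=
    measurable_pi_lambda _ fun x => ((hum x).comp measurable_fst).add ((measurable_pi_apply x).comp measurable_snd)
  have hWξ : ∀ ξ : B1Eq324BenfattoLemma.Site d → ℝ, Measurable fun ζ : B1Eq324BenfattoLemma.Site d → ℝ => W (ξ, ζ) :=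
    fun ξ => hWm.comp (measurable_const.prodMk measurable_id)
  have hres : Measurable fun ξ : B1Eq324BenfattoLemma.Site d → ℝ => Γ.restrict ξ := Finset.measurable_restrict Γ
  -- the integrand on the product space
  set h : (B1Eq324BenfattoLemma.Site d → ℝ) × (B1Eq324BenfattoLemma.Site d → ℝ) → ℝ := fun p => g (Γ.restrict p.1, W p) with hh
  have hhm : Measurable h := hg.comp ((hres.comp measurable_fst).prodMk hWm)
  have hhint : Integrable h ν :=
    Integrable.of_bound hhm.aestronglyMeasurable M (ae_of_all _ fun p => by
      rw [Real.norm_eq_abs]; exact hM _)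
  -- RHS = ∫∫ h
  have hinner : ∀ ξ : B1Eq324BenfattoLemma.Site d → ℝ,
      ∫ z, g (Γ.restrict ξ, z) ∂condField d α β Γ ξ = ∫ ζ, h (ξ, ζ) ∂Q := by
    intro ξ
    have hcf : condField d α β Γ ξ = Q.map fun ζ => W (ξ, ζ) := rfl
    rw [hcf, integral_map (hWξ ξ).aemeasurable]
    exact (hg.comp (measurable_const.prodMk measurable_id)).aestronglyMeasurable
  simp_rw [hinner]
  rw [← integral_prod h hhint]
  -- ∫ h dν = ∫ g(Γ.restrict (W p), W p) dν = ∫ G d(ν.map W) = ∫ G dμ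
  have hae : (fun p => h p) =ᵐ[ν] fun p => g (Γ.restrict (W p), W p) := by
    filter_upwards [coupling_apply_ae_eq_of_mem hα hβ Γ] with p hp
    simp only [hh]
    congr 2
    funext c
    simp only [Finset.restrict, hW]
    exact (hp c c.2).symm
  rw [integral_congr_ae hae]
  have hG : Measurable fun z : B1Eq324BenfattoLemma.Site d → ℝ => g (Γ.restrict z, z) := hg.comp (hres.prodMk measurable_id)
  have hmapW := map_coupling_eq_P0 hα hβ Γ
  have := integral_map (μ := ν) (φ := W) hWm.aemeasurable (f := fun z => g (Γ.restrict z, z)) hG.aestronglyMeasurable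
  rw [← hν, ← hK, ← hμ] at hmapW
  rw [hmapW] at this
  exact this

end Coupling

end Literature.MathematicalPhysics.QuantumFieldTheory.Balaban1983to89.B1Eq324BenfattoCondLaw

end
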